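import Mathlib
import HarnessLib

/-!
# `DigitPolyUniformity` (stmt-QuantumAdvantage-1392), line `Sketch` — stub `stub_noSmallRelation`
# (Stub B: no small relations among `2`-adic logarithms of odd primes)

Crux `Summit.QuantumAdvantage.QuantumAdvantage.Theses.MobiusLadder.DigitPolyUniformity` (route
`MobiusLadder`); line `Sketch`, cycle 6 (chirps).

`ind` is an abstract `2`-adic discrete logarithm modulo `2^k`: every odd `u` satisfies
`u ≡ ± 5^{ind u} (mod 2^k)`, `ind u < 2^(k-2)`, and `ind` is additive (mod `2^(k-2)`) on products of odd
numbers.  This file proves that the vector `(ind p)_{p ∈ S}` of logarithms of a finite set `S` of odd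
primes admits no nonzero integer relation `∑ c_p · ind p ≡ 0 (mod 2^(k-2))` with `|c_p| ≤ L`, provided
`(∏_{p ∈ S} p)^L < 2^(k-1)`.

Proof (unique factorisation): put `P := ∏ p^{(c p)⁺}` and `Q := ∏ p^{(c p)⁻}`.  Both are odd, lie in
`[1, 2^(k-1))`, and `ind P ≡ ∑ (c p)⁺ ind p ≡ ∑ (c p)⁻ ind p ≡ ind Q (mod 2^(k-2))`, so `ind P = ind Q`.
Hence `P ≡ ± Q (mod 2^k)`; the size bounds force `P = Q`, and since `P`, `Q` are coprime, `P = Q = 1`,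
so all exponents vanish.
-/

noncomputable section

namespace Summit.QuantumAdvantage.DigitPolyUniformity.SketchLAR.Chirp

open Finset

/-- An additive (mod `2^(k-2)`) index map on odd numbers sends `1` to `0` (mod `2^(k-2)`). [folklore] -/
theorem ind_one_modEq_zero (k : ℕ) (ind : ℕ → ℕ)
    (hhom : ∀ u v, Odd u → Odd v → ind (u * v) = (ind u + ind v) % 2 ^ (k - 2)) :
    ind 1 ≡ 0 [MOD 2 ^ (k - 2)] := by
  have h := hhom 1 1 odd_one odd_one
  rw [mul_one] at h
  have h1 : ind 1 + ind 1 ≡ ind 1 + 0 [MOD 2 ^ (k - 2)] :=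
    calc ind 1 + ind 1 ≡ (ind 1 + ind 1) % 2 ^ (k - 2) [MOD 2 ^ (k - 2)] := (Nat.mod_modEq _ _).symm
      _ = ind 1 + 0 := by rw [add_zero]; exact h.symm
  exact Nat.ModEq.add_left_cancel' (ind 1) h1

/-- An additive (mod `2^(k-2)`) index map on odd numbers satisfies `ind (u^n) ≡ n · ind u`.
[folklore] -/
theorem ind_pow_modEq (k : ℕ) (ind : ℕ → ℕ)
    (hhom : ∀ u v, Odd u → Odd v → ind (u * v) = (ind u + ind v) % 2 ^ (k - 2))
    (u : ℕ) (hu : Odd u) (n : ℕ) :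
    ind (u ^ n) ≡ n * ind u [MOD 2 ^ (k - 2)] := by
  induction n with
  | zero => simpa using ind_one_modEq_zero k ind hhom
  | succ n ih =>
    rw [pow_succ, hhom _ _ hu.pow hu, add_mul, one_mul]
    exact (Nat.mod_modEq _ _).trans (Nat.ModEq.add_right _ ih)

/-- An additive (mod `2^(k-2)`) index map on odd numbers is additive on products of powers of odd
numbers: `ind (∏ p^{e p}) ≡ ∑ e p · ind p`. [folklore] -/
theorem ind_prod_pow_modEq (k : ℕ) (ind : ℕ → ℕ)
    (hhom : ∀ u v, Odd u → Odd v → ind (u * v) = (ind u + ind v) % 2 ^ (k - 2))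
    (e : ℕ → ℕ) (S : Finset ℕ) (hS : ∀ p ∈ S, Odd p) :
    ind (∏ p ∈ S, p ^ e p) ≡ ∑ p ∈ S, e p * ind p [MOD 2 ^ (k - 2)] := by
  classical
  induction S using Finset.induction_on with
  | empty => simpa using ind_one_modEq_zero k ind hhom
  | insert a S ha ih =>
    have hS' : ∀ p ∈ S, Odd p := fun p hp => hS p (Finset.mem_insert_of_mem hp)
    have hodd : Odd (∏ p ∈ S, p ^ e p) :=
      Finset.prod_induction _ _ (fun x y hx hy => hx.mul hy) odd_one (fun p hp => (hS' p hp).pow)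
    have haodd : Odd a := hS a (Finset.mem_insert_self a S)
    rw [Finset.prod_insert ha, Finset.sum_insert ha, hhom _ _ haodd.pow hodd]
    exact (Nat.mod_modEq _ _).trans ((ind_pow_modEq k ind hhom a haodd (e a)).add (ih hS'))

/-- **No small relations among `2`-adic logarithms of odd primes.**  If `ind` is a `2`-adic discrete
logarithm mod `2^k` (odd `u ≡ ± 5^{ind u}`, `ind u < 2^(k-2)`, additive on odd products), `S` is a finite
set of odd primes with `(∏_{p∈S} p)^L < 2^(k-1)`, and `∑_{p∈S} c_p · ind p ≡ 0 (mod 2^(k-2))` with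
`|c_p| ≤ L`, then all `c_p = 0`. [folklore] -/
theorem stub_noSmallRelation (k : ℕ) (ind : ℕ → ℕ)
    (hlt : ∀ u, ind u < 2 ^ (k - 2))
    (hpm : ∀ u, Odd u → u % 2 ^ k = 5 ^ ind u % 2 ^ k ∨ (u + 5 ^ ind u) % 2 ^ k = 0)
    (hhom : ∀ u v, Odd u → Odd v → ind (u * v) = (ind u + ind v) % 2 ^ (k - 2))
    (S : Finset ℕ) (hS : ∀ p ∈ S, p.Prime ∧ Odd p) (L : ℕ)
    (hL : (∏ p ∈ S, p) ^ L < 2 ^ (k - 1))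
    (c : ℕ → ℤ) (hc : ∀ p ∈ S, |c p| ≤ L)
    (hrel : ((2 ^ (k - 2) : ℕ) : ℤ) ∣ ∑ p ∈ S, c p * (ind p : ℤ)) :
    ∀ p ∈ S, c p = 0 := by
  classical
  -- the positive and negative parts of the relation, as odd numbers
  set P : ℕ := ∏ p ∈ S, p ^ (c p).toNat with hP
  set Q : ℕ := ∏ p ∈ S, p ^ (-(c p)).toNat with hQ
  -- `k ≥ 1` (otherwise `hL` fails) and `2^(k-1) + 2^(k-1) = 2^k`
  have hprodpos : 0 < (∏ p ∈ S, p) ^ L := pow_pos (Finset.prod_pos fun p hp => (hS p hp).1.pos) L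
  have hk : k ≠ 0 := by
    rintro rfl
    rw [Nat.zero_sub, pow_zero] at hL
    omega
  have hM : 2 ^ (k - 1) + 2 ^ (k - 1) = 2 ^ k := by
    rw [← two_mul, ← pow_succ']
    congr 1
    omega
  -- oddness and positivity
  have hPodd : Odd P :=
    Finset.prod_induction _ _ (fun x y hx hy => hx.mul hy) odd_one (fun p hp => (hS p hp).2.pow)
  have hQodd : Odd Q :=
    Finset.prod_induction _ _ (fun x y hx hy => hx.mul hy) odd_one (fun p hp => (hS p hp).2.pow)
  have hPpos : 0 < P := hPodd.pos
  have hQpos : 0 < Q := hQodd.pos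
  -- size bounds
  have hbound : ∀ e : ℕ → ℕ, (∀ p ∈ S, e p ≤ L) → ∏ p ∈ S, p ^ e p < 2 ^ (k - 1) := by
    intro e he
    calc ∏ p ∈ S, p ^ e p ≤ ∏ p ∈ S, p ^ L :=
          Finset.prod_le_prod (fun p _ => Nat.zero_le _)
            (fun p hp => Nat.pow_le_pow_right (hS p hp).1.pos (he p hp))
      _ = (∏ p ∈ S, p) ^ L := Finset.prod_pow S L (fun p => p)
      _ < 2 ^ (k - 1) := hL
  have hPlt : P < 2 ^ (k - 1) :=
    hbound (fun p => (c p).toNat) (fun p hp => by have := abs_le.mp (hc p hp); omega)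
  have hQlt : Q < 2 ^ (k - 1) :=
    hbound (fun p => (-(c p)).toNat) (fun p hp => by have := abs_le.mp (hc p hp); omega)
  -- the indices of `P` and `Q` agree modulo `2^(k-2)`, hence are equal
  have hindP : ind P ≡ ∑ p ∈ S, (c p).toNat * ind p [MOD 2 ^ (k - 2)] :=
    ind_prod_pow_modEq k ind hhom (fun p => (c p).toNat) S (fun p hp => (hS p hp).2)
  have hindQ : ind Q ≡ ∑ p ∈ S, (-(c p)).toNat * ind p [MOD 2 ^ (k - 2)] :=
    ind_prod_pow_modEq k ind hhom (fun p => (-(c p)).toNat) S (fun p hp => (hS p hp).2)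
  have hAB : ∑ p ∈ S, (-(c p)).toNat * ind p ≡ ∑ p ∈ S, (c p).toNat * ind p [MOD 2 ^ (k - 2)] := by
    refine Nat.modEq_iff_dvd.mpr ?_
    have h : ((∑ p ∈ S, (c p).toNat * ind p : ℕ) : ℤ) - ((∑ p ∈ S, (-(c p)).toNat * ind p : ℕ) : ℤ)
        = ∑ p ∈ S, c p * (ind p : ℤ) := by
      rw [Nat.cast_sum, Nat.cast_sum, ← Finset.sum_sub_distrib]
      refine Finset.sum_congr rfl fun p _ => ?_
      rw [Nat.cast_mul, Nat.cast_mul, ← sub_mul, Int.toNat_sub_toNat_neg]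
    rw [h]
    exact hrel
  have hPQmod : ind P ≡ ind Q [MOD 2 ^ (k - 2)] := (hindP.trans hAB.symm).trans hindQ.symm
  have ht : ind P = ind Q := Nat.ModEq.eq_of_lt_of_lt hPQmod (hlt P) (hlt Q)
  -- hence `P ≡ ± Q (mod 2^k)`, and the size bounds give `P = Q`
  have hPQ : P = Q := by
    rcases hpm P hPodd with h1 | h1 <;> rcases hpm Q hQodd with h2 | h2
    · rw [ht] at h1
      have h3 : P % 2 ^ k = Q % 2 ^ k := h1.trans h2.symm
      rwa [Nat.mod_eq_of_lt (by omega), Nat.mod_eq_of_lt (by omega)] at h3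
    · exfalso
      rw [ht] at h1
      have h3 : (Q + P) % 2 ^ k = 0 := by rw [Nat.add_mod, h1, ← Nat.add_mod]; exact h2
      have h4 := Nat.eq_zero_of_dvd_of_lt (Nat.dvd_of_mod_eq_zero h3) (by omega)
      omega
    · exfalso
      rw [ht] at h1
      have h3 : (P + Q) % 2 ^ k = 0 := by rw [Nat.add_mod, h2, ← Nat.add_mod]; exact h1
      have h4 := Nat.eq_zero_of_dvd_of_lt (Nat.dvd_of_mod_eq_zero h3) (by omega)
      omega
    · rw [ht] at h1
      have h3 : P + 5 ^ ind Q ≡ Q + 5 ^ ind Q [MOD 2 ^ k] := h1.trans h2.symm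
      have h4 : P ≡ Q [MOD 2 ^ k] := Nat.ModEq.add_right_cancel' _ h3
      exact Nat.ModEq.eq_of_lt_of_lt h4 (by omega) (by omega)
  -- `P` and `Q` are coprime, so `P = Q = 1`
  have hcop : Nat.Coprime P Q := by
    refine Nat.Coprime.prod_left fun p hp => Nat.Coprime.prod_right fun q hq => ?_
    by_cases hpq : p = q
    · subst hpq
      rcases le_total (c p) 0 with h0 | h0
      · rw [Int.toNat_of_nonpos h0, pow_zero]
        exact Nat.coprime_one_left _
      · rw [Int.toNat_of_nonpos (neg_nonpos.mpr h0), pow_zero]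
        exact Nat.coprime_one_right _
    · exact Nat.Coprime.pow _ _ ((Nat.coprime_primes (hS p hp).1 (hS q hq).1).mpr hpq)
  have hQ1 : Q = 1 := by rwa [hPQ, Nat.coprime_self] at hcop
  have hP1 : P = 1 := hPQ.trans hQ1
  -- conclude: every exponent vanishes
  intro p hp
  have hp1 : p ≠ 1 := (hS p hp).1.ne_one
  have h1 : p ^ (c p).toNat ∣ P := Finset.dvd_prod_of_mem (fun q => q ^ (c q).toNat) hp
  have h2 : p ^ (-(c p)).toNat ∣ Q := Finset.dvd_prod_of_mem (fun q => q ^ (-(c q)).toNat) hp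
  rw [hP1, Nat.dvd_one, Nat.pow_eq_one] at h1
  rw [hQ1, Nat.dvd_one, Nat.pow_eq_one] at h2
  have e1 : (c p).toNat = 0 := h1.resolve_left hp1
  have e2 : (-(c p)).toNat = 0 := h2.resolve_left hp1
  omega

end Summit.QuantumAdvantage.DigitPolyUniformity.SketchLAR.Chirp

end
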